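import Summits.ABC.IUTFork.Joshi.ATS4LogDiffConductor
import Literature.IUT.LogVolume.DifferentConductorTowerBounds
import HarnessLib

/-!
# Joshi, *Arithmetic Teichmüller Spaces IV* (arXiv:2403.10430v2) Thm. 4.6.1 (5) / Cor. 4.6.15 in the GALOIS case — PROVED over
# Mathlib number fields with the constant `Σ_{p ∈ S^ℚ_wild} (v_p(N) + 1)·log p`

Proof-only companion of `Joshi/ATS4LogDiffConductor.lean` (abc-iut cell, branch E, rung LADDER-ABC:A2.E; seat abc-iut-E-t27,
slot T-27). **No side is taken** on [IUTchIII] Cor. 3.12, on Joshi's claims, or on Mochizuki's reports on them; the source is an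
unrefereed arXiv preprint. Locators «p.N l.M» refer to the render `HOME/lit/renders/Joshi-arxiv-2403.10430/` (v2).

The typed claims `WildBound L M S S_wild` (Thm. 4.6.1 (5), p.46 l.42–46: `Δ ≤ #S^ℚ_wild·log[M:L]` for `M/L` wildly ramified
only above `S_wild`) and `Cor4615` (p.49 l.4–18) rest on the non-Galois different bound [Bombieri–Gubler 2006, B.2.12], not
packaged for number fields in the tree. In the GALOIS case — which covers both uses of (5) in [J-IV] (Lem. 6.4.1: `L/L_tpd`,
Galois by Lem. 4.1.2; Lem. 6.4.2: `L′/L`) — the tree's kernel form of [IUTchIV] Thm. 1.10 Step (ii)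
(`Literature.IUT.LogVolume.ndeg_different_add_reduced_le_of_isGalois`, Dedekind–Hensel `ord_w 𝔡_{M/L} < e(w|p)·(v_p(N)+1)` at
the wild primes, tame equality / unramified vanishing elsewhere) gives, in the typed §4.6 vocabulary:

* `wildBound_of_isGalois` — for `M/L` Galois with `[M:L] ∣ N`, a finite set `P` of rational primes with `v_p(N) ≤ m(p)`, `M/L`
  unramified at the primes outside `V^{odd,ss}_M` of residue characteristic `∉ P` and tamely ramified at the primes of
  `V^{odd,ss}_M` of residue characteristic `∉ P`:
  **`(log d_M + log f_M) − (log d_L + log f_L) ≤ Σ_{p ∈ P} (m(p) + 1)·log p`** — PROVED;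
* `wildBound_of_isGalois_finrank` — the same with `N = [M:L]`, `m(p) = v_p([M:L])`.

Compared with the printed (5) (`#S^ℚ_wild·log[M:L]`): `Σ_{p∈P}(v_p([M:L]) + 1)·log p ≤ #P·log[M:L] + log ∏_{p∈P} p`; the
hypotheses make explicit the condition flag F-b located («unramified outside V^{odd,ss}_M», here off `P`). The non-Galois case
stays the typed hypothesis. Theorems only; standard axioms; no `sorry`, instance, notation or new `Prop` fact.
[claim: Joshi2024ATS4, status: disputed] (provenance of the typed items; nothing endorsed).
-/

noncomputable section

namespace Summit.ABC.IUTFork.Joshi.ATS4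

namespace LogDiffCond

open NumberField IsDedekindDomain Ideal Module Literature.IUT.LogVolume
open Literature.NumberTheory.NumberFields (natCast_mem_iff_absNorm_under_dvd)

variable (L M : Type*) [Field L] [NumberField L] [Field M] [NumberField M] [Algebra L M]

/-! ### Glue (private copies; public versions in `Joshi/ATS4LogDiffConductorIdentity.lean`) -/

/-- `log d_M + log f_M(T)` is the tree's `ndeg (differentDivisor) + ndeg (reduced T)`. [folklore] -/
private theorem logDiffCond_eq_ndeg' (M : Type*) [Field M] [NumberField M] (T : Finset (HeightOneSpectrum (𝓞 M))) :
    logDiffCond M T = ndeg M (differentDivisor M) + ndeg M (ADivisor.reduced T) := by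
  rw [logDiffCond, logDiff_eq_log_discr, ndeg_apply, degF_differentDivisor, div_eq_inv_mul, logRedTate, ndeg_apply,
    ADivisor.degF_reduced_eq_sum, div_eq_inv_mul]
  rfl

omit [NumberField L] in
/-- `e_{w|v}`: Mathlib `ramificationIdx'` over `w ∩ 𝓞_L` = `Ideal.ramificationIdx` over `𝓞_L`. [folklore] -/
private theorem relRamIdx_eq' (w : HeightOneSpectrum (𝓞 M)) : relRamIdx L M w = w.asIdeal.ramificationIdx (𝓞 L) := by
  haveI := w.isPrime
  exact Ideal.ramificationIdx'_eq_ramificationIdx (w.asIdeal.under (𝓞 L)) w.asIdeal (w.under (𝓞 L)).ne_bot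

omit [NumberField L] [NumberField M] [Algebra L M] in
/-- `ringChar (𝓞 M ⧸ w)` = the cell's `residueChar` (`N(w ∩ ℤ)`). [folklore] -/
private theorem residueChar_eq' (w : HeightOneSpectrum (𝓞 M)) :
    LogDiffCond.residueChar M w = Literature.IUT.LogVolume.residueChar M w := by
  have hprime : (Literature.IUT.LogVolume.residueChar M w).Prime := residueChar_prime M w
  have hmem : ((Literature.IUT.LogVolume.residueChar M w : ℕ) : 𝓞 M) ∈ w.asIdeal :=
    (natCast_mem_iff_absNorm_under_dvd M w.asIdeal _).mpr dvd_rfl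
  haveI : Nontrivial (𝓞 M ⧸ w.asIdeal) := Ideal.Quotient.nontrivial_iff.mpr w.isPrime.ne_top
  refine CharP.ringChar_of_prime_eq_zero hprime ?_
  rw [← map_natCast (Ideal.Quotient.mk w.asIdeal), Ideal.Quotient.eq_zero_iff_mem]
  exact hmem

variable {L M} in
/-- `w ∈ V^{odd,ss}_M ↔ finBelow w ∈ V^{odd,ss}_L`. [folklore] -/
private theorem mem_ssAbove_iff_finBelow' {S : Finset (HeightOneSpectrum (𝓞 L))} (w : HeightOneSpectrum (𝓞 M)) :
    w ∈ ssAbove L M S ↔ finBelow L M w ∈ S := by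
  rw [mem_ssAbove, show finBelow L M w = w.under (𝓞 L) from HeightOneSpectrum.ext rfl]

/-! ### Thm. 4.6.1 (5), Galois case -/

/-- **[J-IV] Thm. 4.6.1 (5) / Cor. 4.6.15, GALOIS case — PROVED** (p.46 l.42–46; proof (4.6.9)–(4.6.14) p.48 l.30 – p.49 l.1): for
`M/L` a Galois extension of number fields with `[M:L] ∣ N` (`N ≠ 0`), `S = V^{odd,ss}_L`, a finite set `P` of rational primes
(the printed `S^ℚ_wild`) with `v_p(N) ≤ m(p)` for `p ∈ P`, and `M/L` unramified at the primes outside `V^{odd,ss}_M` resp. tamely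
ramified at the primes of `V^{odd,ss}_M`, of residue characteristic `∉ P` (the explicit form of «tamely ramified outside S_wild»
together with the located hypothesis F-b «unramified outside V^{odd,ss}»):
`(log d_M + log f_M) − (log d_L + log f_L) ≤ Σ_{p ∈ P} (m(p) + 1)·log p`. The tree's kernel form of [IUTchIV] Thm. 1.10 Step (ii),
second display (`ndeg_different_add_reduced_le_of_isGalois`), transported to the typed vocabulary.
[cite: BombieriGubler2006, Thm B.2.11] -/
theorem wildBound_of_isGalois [IsGalois L M] (S : Finset (HeightOneSpectrum (𝓞 L))) (P : Finset ℕ)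
    (hP : ∀ p ∈ P, p.Prime) {N : ℕ} (hN : N ≠ 0) (hdvd : finrank L M ∣ N) (m : ℕ → ℕ)
    (hm : ∀ p ∈ P, N.factorization p ≤ m p)
    (hunr : ∀ w : HeightOneSpectrum (𝓞 M), residueChar M w ∉ P → w ∉ ssAbove L M S → relRamIdx L M w = 1)
    (htame : ∀ w : HeightOneSpectrum (𝓞 M), residueChar M w ∉ P → w ∈ ssAbove L M S → IsTameAt L M w) :
    logDiffCond M (ssAbove L M S) - logDiffCond L S ≤ ∑ p ∈ P, ((m p + 1 : ℕ) : ℝ) * Real.log p := by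
  have key := ndeg_different_add_reduced_le_of_isGalois L M S (ssAbove L M S) (fun w => mem_ssAbove_iff_finBelow' w) P hP
    hN hdvd m hm
    (fun w hp hS => by
      rw [← relRamIdx_eq']
      exact hunr w (by rwa [residueChar_eq']) (by rwa [mem_ssAbove_iff_finBelow']))
    (fun w hp hS => by
      have h := htame w (by rwa [residueChar_eq']) (by rwa [mem_ssAbove_iff_finBelow'])
      rw [IsTameAt, residueChar_eq', relRamIdx_eq'] at h
      exact h)
  rw [logDiffCond_eq_ndeg', logDiffCond_eq_ndeg']
  linarith

/-- **The same with `N = [M:L]` and `m(p) = v_p([M:L])`**: `Δ ≤ Σ_{p ∈ P} (v_p([M:L]) + 1)·log p` — to be compared with the printed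
`#S^ℚ_wild·log[M:L]` (p.46 l.45–46): `Σ_{p∈P}(v_p([M:L]) + 1)·log p ≤ #P·log[M:L] + log ∏_{p∈P} p`.
[cite: BombieriGubler2006, Thm B.2.11] -/
theorem wildBound_of_isGalois_finrank [IsGalois L M] (S : Finset (HeightOneSpectrum (𝓞 L))) (P : Finset ℕ)
    (hP : ∀ p ∈ P, p.Prime)
    (hunr : ∀ w : HeightOneSpectrum (𝓞 M), residueChar M w ∉ P → w ∉ ssAbove L M S → relRamIdx L M w = 1)
    (htame : ∀ w : HeightOneSpectrum (𝓞 M), residueChar M w ∉ P → w ∈ ssAbove L M S → IsTameAt L M w) :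
    logDiffCond M (ssAbove L M S) - logDiffCond L S ≤
      ∑ p ∈ P, (((finrank L M).factorization p + 1 : ℕ) : ℝ) * Real.log p :=
  wildBound_of_isGalois L M S P hP (Nat.pos_iff_ne_zero.mp finrank_pos) dvd_rfl (fun p => (finrank L M).factorization p)
    (fun _ _ => le_rfl) hunr htame

/-- **Each summand against the printed shape**: `(v_p(n) + 1)·log p ≤ log n + log p` for a prime `p` and `n ≥ 1` (`p^{v_p(n)} ≤ n`),
so the Galois constant is at most `#P·log[M:L] + Σ_{p∈P} log p`. [folklore] -/
theorem factorization_succ_mul_log_le {p n : ℕ} (hp : p.Prime) (hn : n ≠ 0) :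
    ((n.factorization p + 1 : ℕ) : ℝ) * Real.log p ≤ Real.log n + Real.log p := by
  have hpow : (p : ℝ) ^ n.factorization p ≤ n := by
    exact_mod_cast Nat.ordProj_le p hn
  have hp1 : (1 : ℝ) < p := by exact_mod_cast hp.one_lt
  have hlogpow : (n.factorization p : ℝ) * Real.log p ≤ Real.log n := by
    rw [← Real.log_pow]
    exact Real.log_le_log (pow_pos (by linarith) _) hpow
  push_cast
  linarith

/-- **Galois form of (5) with the printed main term**: under the hypotheses of `wildBound_of_isGalois_finrank`,
`Δ ≤ #P·log[M:L] + Σ_{p ∈ P} log p`. [cite: BombieriGubler2006, Thm B.2.11] -/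
theorem wildBound_of_isGalois_card [IsGalois L M] (S : Finset (HeightOneSpectrum (𝓞 L))) (P : Finset ℕ)
    (hP : ∀ p ∈ P, p.Prime)
    (hunr : ∀ w : HeightOneSpectrum (𝓞 M), residueChar M w ∉ P → w ∉ ssAbove L M S → relRamIdx L M w = 1)
    (htame : ∀ w : HeightOneSpectrum (𝓞 M), residueChar M w ∉ P → w ∈ ssAbove L M S → IsTameAt L M w) :
    logDiffCond M (ssAbove L M S) - logDiffCond L S ≤
      (P.card : ℝ) * Real.log (finrank L M) + ∑ p ∈ P, Real.log p := by
  have h := wildBound_of_isGalois_finrank L M S P hP hunr htame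
  have hn : finrank L M ≠ 0 := (Nat.pos_iff_ne_zero.mp finrank_pos)
  have hsum : ∑ p ∈ P, (((finrank L M).factorization p + 1 : ℕ) : ℝ) * Real.log p ≤
      ∑ p ∈ P, (Real.log (finrank L M) + Real.log p) :=
    Finset.sum_le_sum fun p hp => factorization_succ_mul_log_le (hP p hp) hn
  rw [Finset.sum_add_distrib, Finset.sum_const, nsmul_eq_mul] at hsum
  linarith

end LogDiffCond

end Summit.ABC.IUTFork.Joshi.ATS4

end
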